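import Mathlib
import Summits.Ventures.HodgeRepro2.T5WedgeRank
import Summits.Ventures.HodgeRepro2.T5IdentityPrinciple
import Summits.Ventures.HodgeRepro2.T5LocalImage

/-!
# T5SurfaceImage — one invertible Jacobian makes the map open on a dense set (chart form of §H6)

Kernel support (blind cell pub-hodge-repro2, seat p6) for route/T5-N1-hodge-p6.md §H6: the chain
(i) `ω_{ab}|_{S_j} ≠ 0` ⟺ (ii)/(iii) «`F_{ab}` has invertible differential at SOME point» ⟺ (iv)
«on a dense open subset» ⟹ «the image `f_{ab}(S_j)` is a surface», composed from the model
files T5WedgeRank (p389622: independence of the two Jacobian rows ⟺ `wedge10 ≠ 0` ⟺ `det ≠ 0`),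
T5IdentityPrinciple (p391747: independent at some point ⟺ independent on a dense subset, for
analytic covector fields on a connected open set) and T5LocalImage (p398509: invertible
differential at `s` ⟹ `F` maps neighbourhoods of `s` onto neighbourhoods of `F s`).

Chart model (Remark A4.2.8). `F : ℂ² → ℂ²` is `F_{ab} = (z_a ∘ f̃_a, z_b ∘ f̃_b)` on a chart
`U ⊂ ℂ²` of the connected component `S_j`; its Jacobian rows `jacRow F z 0`, `jacRow F z 1`
(the coefficient vectors of the two pulled-back `(1,0)`-covectors) are here written out as
`fun i => fderiv ℂ F z (Pi.single i 1) k` — no new definition is introduced.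

* `analyticOnNhd_jacRow`: the Jacobian rows of an analytic map are analytic;
* `of_jacRows_eq_toMatrix'`, `wedge10_jacRows_eq_det`: the matrix of rows is the matrix of
  `fderiv ℂ F z`, and its determinant is the `wedge10` of the rows;
* `surjective_fderiv_of_wedge10_ne_zero`, `map_nhds_eq_of_wedge10_ne_zero`: at a point where the
  rows are independent, `F` is open at that point (inverse function theorem);
* `subset_closure_wedge10_ne_zero`: **(ii) ⟹ (iv)** — independence at one point of the connected
  open `U` gives independence on a dense subset of `U`;
* `subset_closure_map_nhds_eq`: hence `F` is open at the points of a dense subset of `U`;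
* `interior_image_nonempty_of_exists_wedge10_ne_zero`: hence `F '' U` has non-empty interior —
  «the image is a surface».

All declarations: Mathlib + own T5WedgeRank / T5IdentityPrinciple / T5LocalImage, no `sorry`,
axioms ⊆ {propext, Classical.choice, Quot.sound}.
-/

namespace Summit.Ventures.HodgeRepro2.T5SurfaceImage

open Filter Topology Set
open Summit.Ventures.HodgeRepro2

/-! ### The Jacobian rows of an analytic map `ℂ² → ℂ²` -/

/-- The `k`-th Jacobian row `z ↦ (fderiv ℂ F z (e_i) k)_i` of a map analytic on `U` is analytic
on `U` (the derivative of an analytic map is analytic, composed with the continuous linear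
evaluations). -/
theorem analyticOnNhd_jacRow {F : (Fin 2 → ℂ) → (Fin 2 → ℂ)} {U : Set (Fin 2 → ℂ)}
    (hF : AnalyticOnNhd ℂ F U) (k : Fin 2) :
    AnalyticOnNhd ℂ (fun z i => fderiv ℂ F z (Pi.single i 1) k) U := by
  refine AnalyticOnNhd.pi fun i => ?_
  have h := ((ContinuousLinearMap.proj (R := ℂ) (φ := fun _ : Fin 2 => ℂ) k).comp
    (ContinuousLinearMap.apply ℂ (Fin 2 → ℂ) (Pi.single i 1))).comp_analyticOnNhd hF.fderiv
  exact h

/-- The matrix with rows the two Jacobian rows is the matrix of `fderiv ℂ F z` in the standard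
basis (`LinearMap.toMatrix'`). -/
theorem of_jacRows_eq_toMatrix' (F : (Fin 2 → ℂ) → (Fin 2 → ℂ)) (z : Fin 2 → ℂ) :
    Matrix.of ![fun i => fderiv ℂ F z (Pi.single i 1) 0, fun i => fderiv ℂ F z (Pi.single i 1) 1]
      = LinearMap.toMatrix' (fderiv ℂ F z : (Fin 2 → ℂ) →ₗ[ℂ] (Fin 2 → ℂ)) := by
  ext k i
  rw [LinearMap.toMatrix'_apply, ContinuousLinearMap.coe_coe]
  fin_cases k <;> rfl

/-- `wedge10` of the two Jacobian rows is the determinant of the Jacobian matrix. -/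
theorem wedge10_jacRows_eq_det (F : (Fin 2 → ℂ) → (Fin 2 → ℂ)) (z : Fin 2 → ℂ) :
    T5WedgeRank.wedge10 (fun i => fderiv ℂ F z (Pi.single i 1) 0)
        (fun i => fderiv ℂ F z (Pi.single i 1) 1)
      = (LinearMap.toMatrix' (fderiv ℂ F z : (Fin 2 → ℂ) →ₗ[ℂ] (Fin 2 → ℂ))).det := by
  rw [T5WedgeRank.wedge10_eq_det, of_jacRows_eq_toMatrix']

/-! ### At one point: invertible Jacobian ⟹ `F` is open at that point -/

/-- If the Jacobian rows at `z` are independent (`wedge10 ≠ 0`), the differential `fderiv ℂ F z`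
is surjective. -/
theorem surjective_fderiv_of_wedge10_ne_zero {F : (Fin 2 → ℂ) → (Fin 2 → ℂ)} {z : Fin 2 → ℂ}
    (h : T5WedgeRank.wedge10 (fun i => fderiv ℂ F z (Pi.single i 1) 0)
      (fun i => fderiv ℂ F z (Pi.single i 1) 1) ≠ 0) :
    Function.Surjective (fderiv ℂ F z) := by
  rw [wedge10_jacRows_eq_det] at h
  have hs := T5LocalImage.surjective_mulVec_of_det_ne_zero h
  have hm : (LinearMap.toMatrix' (fderiv ℂ F z : (Fin 2 → ℂ) →ₗ[ℂ] (Fin 2 → ℂ))).mulVec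
      = ⇑(fderiv ℂ F z) := by
    funext x
    rw [LinearMap.toMatrix'_mulVec, ContinuousLinearMap.coe_coe]
  rwa [hm] at hs

/-- **§H6 (iii) at `z` ⟹ `F` open at `z`.** If `F` is analytic at `z` and its Jacobian rows at `z`
are independent, `F` maps the neighbourhood filter of `z` onto that of `F z`. -/
theorem map_nhds_eq_of_wedge10_ne_zero {F : (Fin 2 → ℂ) → (Fin 2 → ℂ)} {z : Fin 2 → ℂ}
    (hF : AnalyticAt ℂ F z)
    (h : T5WedgeRank.wedge10 (fun i => fderiv ℂ F z (Pi.single i 1) 0)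
      (fun i => fderiv ℂ F z (Pi.single i 1) 1) ≠ 0) :
    map F (𝓝 z) = 𝓝 (F z) :=
  T5LocalImage.map_nhds_eq_of_analyticAt hF (surjective_fderiv_of_wedge10_ne_zero h)

/-! ### From one point to a dense set -/

/-- **§H6 (ii) ⟹ (iv).** If `F` is analytic on the connected open `U` and its Jacobian rows are
independent at ONE point of `U`, they are independent on a dense subset of `U`
(T5IdentityPrinciple: the identity theorem for the analytic row fields). -/
theorem subset_closure_wedge10_ne_zero {F : (Fin 2 → ℂ) → (Fin 2 → ℂ)} {U : Set (Fin 2 → ℂ)}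
    (hF : AnalyticOnNhd ℂ F U) (hU : IsOpen U) (hUc : IsPreconnected U) (hne : U.Nonempty)
    (h : ∃ z ∈ U, T5WedgeRank.wedge10 (fun i => fderiv ℂ F z (Pi.single i 1) 0)
      (fun i => fderiv ℂ F z (Pi.single i 1) 1) ≠ 0) :
    U ⊆ closure {z | z ∈ U ∧ T5WedgeRank.wedge10 (fun i => fderiv ℂ F z (Pi.single i 1) 0)
      (fun i => fderiv ℂ F z (Pi.single i 1) 1) ≠ 0} := by
  have key := T5IdentityPrinciple.exists_linearIndependent_iff_subset_closure
    (analyticOnNhd_jacRow hF 0) (analyticOnNhd_jacRow hF 1) hUc hU hne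
  simp only [← T5WedgeRank.wedge10_ne_zero_iff] at key
  exact key.mp h

/-- **§H6 ⟹ «surface», pointwise form.** Under the same hypotheses `F` is open (maps `𝓝 z` onto
`𝓝 (F z)`) at the points of a dense subset of `U`. -/
theorem subset_closure_map_nhds_eq {F : (Fin 2 → ℂ) → (Fin 2 → ℂ)} {U : Set (Fin 2 → ℂ)}
    (hF : AnalyticOnNhd ℂ F U) (hU : IsOpen U) (hUc : IsPreconnected U) (hne : U.Nonempty)
    (h : ∃ z ∈ U, T5WedgeRank.wedge10 (fun i => fderiv ℂ F z (Pi.single i 1) 0)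
      (fun i => fderiv ℂ F z (Pi.single i 1) 1) ≠ 0) :
    U ⊆ closure {z | z ∈ U ∧ map F (𝓝 z) = 𝓝 (F z)} :=
  (subset_closure_wedge10_ne_zero hF hU hUc hne h).trans <| closure_mono fun z hz =>
    ⟨hz.1, map_nhds_eq_of_wedge10_ne_zero (hF z hz.1) hz.2⟩

/-- **§H6 ⟹ «the image `f_{ab}(S_j)` is a surface».** If the Jacobian rows of the analytic map
`F` are independent at one point of the open `U`, then `F '' U` has non-empty interior. -/
theorem interior_image_nonempty_of_exists_wedge10_ne_zero {F : (Fin 2 → ℂ) → (Fin 2 → ℂ)}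
    {U : Set (Fin 2 → ℂ)} (hF : AnalyticOnNhd ℂ F U) (hU : IsOpen U)
    (h : ∃ z ∈ U, T5WedgeRank.wedge10 (fun i => fderiv ℂ F z (Pi.single i 1) 0)
      (fun i => fderiv ℂ F z (Pi.single i 1) 1) ≠ 0) :
    (interior (F '' U)).Nonempty := by
  obtain ⟨z, hz, hw⟩ := h
  refine ⟨F z, mem_interior_iff_mem_nhds.mpr ?_⟩
  rw [← map_nhds_eq_of_wedge10_ne_zero (hF z hz) hw]
  exact image_mem_map (hU.mem_nhds hz)

end Summit.Ventures.HodgeRepro2.T5SurfaceImage
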